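import Summits.AtomisticToContinuum.HydrodynamicLimit.Theorems.EquilibriumClampedCollisionalWindowLD.Negative.LatticeDefs
import Summits.AtomisticToContinuum.HydrodynamicLimit.Theorems.EquilibriumClampedCollisionalWindowLD.Negative.BaseParams2
import Summits.AtomisticToContinuum.HydrodynamicLimit.Theorems.EquilibriumClampedCollisionalWindowLD.Negative.Scaling

/-!
# The concrete witness lattice (helper file of the refutation of `EquilibriumClampedCollisionalWindowLD`, stmt-AtomisticToContinuum-13733; see `Cruxes/EquilibriumClampedCollisionalWindowLD/Disproof.lean` and the evidence WITNESS.md; no Theses declaration is asserted positively; refuter-cdisprove-stmt-AtomisticToContinuum-13733-0)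
-/

noncomputable section

open Real
open scoped InnerProductSpace

namespace Summit.AtomisticToContinuum.HydrodynamicLimit.Theorems

namespace EquilibriumClampedCollisionalWindowLDNegative

/-! ## Stage E: the concrete witness lattice -/

section Concrete

open Literature.Analysis.FluidPDE Literature.Analysis.FunctionSpaces Literature.MathematicalPhysics.KineticTheory

/-- Base separation conditions. [folklore] -/
theorem bpar_sepOK {l t : ℕ} (hl : 2 ≤ l) (ht : 24 * l ^ 2 ≤ t) : (bpar l t).SepOK := by
  obtain ⟨h1, h2, h3, h4⟩ := bpar.sep_facts hl ht
  exact { adm := bpar.adm hl ht, αs_le := h1, αn_le := h2, sep2 := h3, adjSS := h4 }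

/-- The scale of the lattice: `c = 1/(l³ n)`. -/
def cscale (l n : ℕ) : ℝ := 1 / ((l : ℝ) ^ 3 * n)

/-- **The witness lattice**: `l³ n` slots per line, `n²` lines, blocks of `6 t⁷ l² + 3` slots, window
`t⁴ /(l n)`. [folklore] -/
def LatW (l n t : ℕ) : Lat :=
  { L := l ^ 3, n := n, m := 6 * t ^ 7 * l ^ 2 + 3, P := (bpar l t).scale (cscale l n),
    w := cscale l n * ((t : ℝ) ^ 4 * (l : ℝ) ^ 2) }

namespace LatW

section defs
variable (l n t : ℕ)
/-- `P_eq` (technical, see the section header). [folklore] -/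
@[simp] theorem P_eq : (LatW l n t).P = (bpar l t).scale (cscale l n) := rfl
/-- `w_eq` (technical, see the section header). [folklore] -/
@[simp] theorem w_eq : (LatW l n t).w = cscale l n * ((t : ℝ) ^ 4 * (l : ℝ) ^ 2) := rfl
/-- `m_eq` (technical, see the section header). [folklore] -/
@[simp] theorem m_eq : (LatW l n t).m = 6 * t ^ 7 * l ^ 2 + 3 := rfl
/-- `n_eq` (technical, see the section header). [folklore] -/
@[simp] theorem n_eq : (LatW l n t).n = n := rfl
/-- `L_eq` (technical, see the section header). [folklore] -/
@[simp] theorem L_eq : (LatW l n t).L = l ^ 3 := rfl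
/-- `M_eq` (technical, see the section header). [folklore] -/
theorem M_eq : (LatW l n t).M = l ^ 3 * n := rfl
end defs

variable {l n t : ℕ} (hl : 2 ≤ l) (ht : 24 * l ^ 2 ≤ t) (hn : 1 ≤ n)
include hl ht hn

omit ht in
/-- `c_pos` (technical, see the section header). [folklore] -/
theorem c_pos : 0 < cscale l n := by
  unfold cscale; have : (0:ℝ) < l := by exact_mod_cast (show 0 < l by omega)
  have : (0:ℝ) < n := by exact_mod_cast (show 0 < n by omega)
  positivity

omit ht in
/-- `c_le` (technical, see the section header). [folklore] -/
theorem c_le : cscale l n ≤ 1 / 8 := by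
  unfold cscale
  have hl2 : (2:ℝ) ≤ l := by exact_mod_cast hl
  have hn1 : (1:ℝ) ≤ n := by exact_mod_cast hn
  have hl8 : (2:ℝ) ^ 3 ≤ (l : ℝ) ^ 3 := pow_le_pow_left₀ (by norm_num) hl2 3
  have : (8:ℝ) ≤ (l : ℝ) ^ 3 * n := by nlinarith
  exact one_div_le_one_div_of_le (by norm_num) this

/-- Structural hypotheses. [folklore] -/
theorem ok : (LatW l n t).OK where
  m_ge := by rw [m_eq]; omega
  K_eq := by show (bpar l t).K + 1 = 6 * t ^ 7 * l ^ 2 + 3; rw [bpar.K_eq]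
  n_pos := by rw [n_eq]; omega
  M_pos := by rw [M_eq]; have : 0 < l ^ 3 := pow_pos (by omega) 3; positivity
  s_eq := by
    show cscale l n * (bpar l t).s = 1 / (((LatW l n t).M : ℕ) : ℝ)
    rw [bpar.s_eq, mul_one, M_eq, cscale]; push_cast; ring
  sep := Params.SepOK.scale _ (c_pos hl hn) (bpar_sepOK hl ht)

/-- Window hypotheses, given the chart condition `4 (K + 2) ≤ l³ n`. [folklore] -/
theorem winOK (hchart : 4 * (6 * (t : ℝ) ^ 7 * (l : ℝ) ^ 2 + 4) ≤ (l : ℝ) ^ 3 * n) : (LatW l n t).WinOK := by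
  have hc := c_pos hl hn
  have hc8 := c_le hl hn
  have hc' := hc.ne'
  obtain ⟨w1, w2, w3, w4, w5, w6, w7, w8, w9, w10⟩ := bpar.win_facts hl ht
  obtain ⟨hf0, hf⟩ := bpar.fwd_bd hl ht
  have hP := bpar.adm hl ht
  refine
  { ok := ok hl ht hn
    w_nn := by rw [w_eq]; positivity
    w_le_T := by rw [w_eq, P_eq, Params.scale_T]; exact mul_le_mul_of_nonneg_left w1 hc.le
    w_lt := by
      rw [w_eq, P_eq, Params.scale_K, Params.scale_θlo _ hc']
      calc cscale l n * ((t : ℝ) ^ 4 * (l : ℝ) ^ 2) < cscale l n * ((((bpar l t).K - 1 : ℕ) : ℝ) * (bpar l t).θlo) :=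
            mul_lt_mul_of_pos_left w2 hc
        _ = _ := by ring
    chart := ?_
    maxv := by rw [P_eq, Params.scale_u, Params.scale_ρs _ hc', Params.scale_Vhi _ hc']; exact w3
    trans_sep := ?_
    long_sep := by
      rw [P_eq, Params.scale_ε, Params.scale_errA _ hc', Params.scale_s, Params.errA]
      have := mul_lt_mul_of_pos_left w6 hc; nlinarith
    fe_le := by
      rw [P_eq, Params.scale_fwd _ hc', Params.scale_errA _ hc', Params.scale_s, Params.errA, Params.fwd]
      have := mul_le_mul_of_nonneg_left w7 hc.le; nlinarith
    s_le := by rw [P_eq, Params.scale_s, bpar.s_eq, mul_one]; linarith }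
  · -- chart: `c ((K+1) + 2 fwd_b) ≤ 1/4`
    rw [P_eq, Params.scale_K, Params.scale_s, Params.scale_fwd _ hc', bpar.s_eq, mul_one, bpar.K_cast, Params.fwd]
    have hfb : (bpar l t).θhi * (bpar l t).Vhi + ((bpar l t).r + (bpar l t).Tmax * (bpar l t).u) +
        (bpar l t).Tmax * (bpar l t).ρs ≤ 1 / 2 := by
      have := bpar.tiny hl ht (by norm_num : (0:ℝ) ≤ 3) le_rfl; linarith
    have hl0 : (0:ℝ) < (l : ℝ) ^ 3 * n := by
      have : (0:ℝ) < l := by exact_mod_cast (show 0 < l by omega)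
      have : (0:ℝ) < n := by exact_mod_cast (show 0 < n by omega)
      positivity
    have key : cscale l n * (6 * (t : ℝ) ^ 7 * (l : ℝ) ^ 2 + 4) ≤ 1 / 4 := by
      unfold cscale
      rw [div_mul_eq_mul_div, one_mul, div_le_iff₀ hl0]; linarith
    have e : (6 * (t : ℝ) ^ 7 * (l : ℝ) ^ 2 + 2 + 1) * cscale l n +
        2 * (cscale l n * ((bpar l t).θhi * (bpar l t).Vhi + ((bpar l t).r + (bpar l t).Tmax * (bpar l t).u) +
          (bpar l t).Tmax * (bpar l t).ρs)) =
        cscale l n * (6 * (t : ℝ) ^ 7 * (l : ℝ) ^ 2 + 3 + 2 * ((bpar l t).θhi * (bpar l t).Vhi +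
          ((bpar l t).r + (bpar l t).Tmax * (bpar l t).u) + (bpar l t).Tmax * (bpar l t).ρs)) := by ring
    rw [e]
    calc cscale l n * (6 * (t : ℝ) ^ 7 * (l : ℝ) ^ 2 + 3 + 2 * ((bpar l t).θhi * (bpar l t).Vhi +
          ((bpar l t).r + (bpar l t).Tmax * (bpar l t).u) + (bpar l t).Tmax * (bpar l t).ρs))
        ≤ cscale l n * (6 * (t : ℝ) ^ 7 * (l : ℝ) ^ 2 + 4) := mul_le_mul_of_nonneg_left (by linarith) hc.le
      _ ≤ 1 / 4 := key
  · -- trans_sep: `c (ε_b + 2 fwd_b) < 1/n`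
    rw [P_eq, Params.scale_ε, Params.scale_fwd _ hc', n_eq, Params.fwd]
    have hn0 : (0:ℝ) < n := by exact_mod_cast (show 0 < n by omega)
    have hl1 : (0:ℝ) < l := by exact_mod_cast (show 0 < l by omega)
    have hl0 : (0:ℝ) < (l : ℝ) ^ 3 := by positivity
    have hl2 : (2:ℝ) ≤ l := by exact_mod_cast hl
    have hl8 : (8:ℝ) ≤ (l : ℝ) ^ 3 := by
      have := pow_le_pow_left₀ (by norm_num : (0:ℝ) ≤ 2) hl2 3; norm_num at this; exact this
    have e : cscale l n * (bpar l t).ε + 2 * (cscale l n * ((bpar l t).θhi * (bpar l t).Vhi +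
        ((bpar l t).r + (bpar l t).Tmax * (bpar l t).u) + (bpar l t).Tmax * (bpar l t).ρs)) =
        (((bpar l t).ε + 2 * ((bpar l t).θhi * (bpar l t).Vhi +
        ((bpar l t).r + (bpar l t).Tmax * (bpar l t).u) + (bpar l t).Tmax * (bpar l t).ρs)) / (l : ℝ) ^ 3) * (1 / n) := by
      unfold cscale; ring
    rw [e]
    calc _ < 1 * (1 / (n : ℝ)) := by
          refine mul_lt_mul_of_pos_right ?_ (by positivity)
          rw [div_lt_one hl0]; linarith
      _ = 1 / n := one_mul _

/-- Gain hypotheses. [folklore] -/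
theorem gainOK : (LatW l n t).GainOK := by
  have hc := c_pos hl hn
  have hc8 := c_le hl hn
  have hc' := hc.ne'
  obtain ⟨-, -, -, -, -, -, -, -, w9, w10⟩ := bpar.win_facts hl ht
  refine ⟨?_, ?_⟩
  · rw [P_eq, Params.scale_errA _ hc', Params.scale_fwd _ hc', Params.scale_ε, Params.errA, Params.fwd]
    have e : 2 * Real.pi * (cscale l n * ((bpar l t).r + (bpar l t).Tmax * (bpar l t).u + (bpar l t).Tmax * (bpar l t).ρs) +
        cscale l n * ((bpar l t).θhi * (bpar l t).Vhi + ((bpar l t).r + (bpar l t).Tmax * (bpar l t).u) +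
          (bpar l t).Tmax * (bpar l t).ρs)) + Real.pi * (cscale l n * (bpar l t).ε) =
        cscale l n * (2 * Real.pi * (((bpar l t).r + (bpar l t).Tmax * (bpar l t).u + (bpar l t).Tmax * (bpar l t).ρs) +
          ((bpar l t).θhi * (bpar l t).Vhi + ((bpar l t).r + (bpar l t).Tmax * (bpar l t).u) +
          (bpar l t).Tmax * (bpar l t).ρs)) + Real.pi * (bpar l t).ε) := by ring
    rw [e]
    calc _ ≤ cscale l n * (39 / 10) := mul_le_mul_of_nonneg_left w9 hc.le
      _ ≤ (1 / 8) * (39 / 10) := mul_le_mul_of_nonneg_right hc8 (by norm_num)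
      _ ≤ 1 / 2 := by norm_num
  · rw [P_eq, Params.scale_u, Params.scale_clo _ hc']; exact w10

omit ht in
/-- The diameter of the statement is the lattice diameter: `σ (N+1)^{-1/3} = (4/5)/(l³ n)` for
`σ = (4/5)/l²`, `N + 1 = (l n)³`. [folklore] -/
theorem hsDiameter_eq {N : ℕ} (hN : N + 1 = (l * n) ^ 3) :
    hsDiameter ((4 / 5) / (l : ℝ) ^ 2) N = (LatW l n t).P.ε := by
  rw [P_eq, Params.scale_ε, bpar.ε_eq, hsDiameter, hN, cscale]
  have hl0 : (0:ℝ) < l := by exact_mod_cast (show 0 < l by omega)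
  have hn0 : (0:ℝ) < n := by exact_mod_cast (show 0 < n by omega)
  have hx : (0:ℝ) ≤ (l : ℝ) * n := by positivity
  push_cast
  rw [← Real.rpow_natCast ((l : ℝ) * n) 3, ← Real.rpow_mul hx]
  norm_num
  rw [Real.rpow_neg_one]
  field_simp

omit ht in
/-- The window of the statement is the lattice window: `τ (N+1)^{-1/3} = t⁴/(l n)`. [folklore] -/
theorem w_eq_stmt {N : ℕ} (hN : N + 1 = (l * n) ^ 3) :
    ((t : ℝ) ^ 4) * ((N : ℝ) + 1) ^ (-(1 / 3 : ℝ)) = (LatW l n t).w := by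
  rw [w_eq, cscale]
  have hl0 : (0:ℝ) < l := by exact_mod_cast (show 0 < l by omega)
  have hn0 : (0:ℝ) < n := by exact_mod_cast (show 0 < n by omega)
  have hx : (0:ℝ) ≤ (l : ℝ) * n := by positivity
  have hN' : ((N : ℝ) + 1) = ((l : ℝ) * n) ^ 3 := by exact_mod_cast hN
  rw [hN', ← Real.rpow_natCast ((l : ℝ) * n) 3, ← Real.rpow_mul hx]
  norm_num
  rw [Real.rpow_neg_one]
  field_simp

/-- `ε < 1/2`, `r < 1/2`, `σ ≤ 1/2`. -/
theorem small_facts : (LatW l n t).P.ε < 1 / 2 ∧ (LatW l n t).P.r < 1 / 2 ∧ (4 / 5 : ℝ) / (l : ℝ) ^ 2 ≤ 1 / 2 := by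
  have hc := c_pos hl hn
  have hc8 := c_le hl hn
  have hl2 : (2:ℝ) ≤ l := by exact_mod_cast hl
  rw [P_eq, Params.scale_ε, Params.scale_r, bpar.ε_eq, bpar.r_eq]
  have hr : (4 / 5 : ℝ) / (t : ℝ) ^ 32 ≤ 1 := by
    have := bpar.small hl ht (by norm_num : 1 ≤ 32)
    have e : (4 / 5 : ℝ) / (t : ℝ) ^ 32 = (4 / 5) * (1 / (t : ℝ) ^ 32) := by ring
    linarith
  refine ⟨by nlinarith, by nlinarith, ?_⟩
  rw [div_le_iff₀ (by positivity)]; nlinarith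

end LatW

/-! ### Counting the active blocks -/

namespace Lat

variable (Λ : Lat)

open Classical in
/-- **At least `M/(4m)` active blocks** when `M ≥ 24 m`. [folklore] -/
theorem card_active_ge (hΛ : Λ.OK) (hM : 24 * Λ.m ≤ Λ.M) :
    (Λ.M : ℝ) / (4 * Λ.m) ≤ (((Finset.range Λ.Q).filter Λ.Active).card : ℝ) := by
  have hm : 0 < Λ.m := by have := hΛ.m_ge; omega
  have hMpos := hΛ.M_pos
  set b₁ := 7 * Λ.M / (12 * Λ.m) + 1 with hb₁
  set b₂ := 11 * Λ.M / (12 * Λ.m) with hb₂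
  have hs := hΛ.s_eq
  have hM0 : (0:ℝ) < Λ.M := by exact_mod_cast hMpos
  have hm0 : (0:ℝ) < Λ.m := by exact_mod_cast hm
  -- every `b ∈ [b₁, b₂)` is active
  have hsub : Finset.Ico b₁ b₂ ⊆ (Finset.range Λ.Q).filter Λ.Active := by
    intro b hb
    rw [Finset.mem_Ico] at hb
    have hb2' : (b + 1) * (12 * Λ.m) ≤ 11 * Λ.M := by
      have := Nat.div_mul_le_self (11 * Λ.M) (12 * Λ.m)
      calc (b + 1) * (12 * Λ.m) ≤ b₂ * (12 * Λ.m) := Nat.mul_le_mul_right _ hb.2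
        _ ≤ 11 * Λ.M := this
    have hb1' : 7 * Λ.M < b * (12 * Λ.m) := by
      have := Nat.lt_div_mul_add (a := 7 * Λ.M) (b := 12 * Λ.m) (by positivity)
      -- `7M < (7M/(12m) + 1) (12 m) ≤ b (12 m)`
      calc 7 * Λ.M < (7 * Λ.M / (12 * Λ.m)) * (12 * Λ.m) + 12 * Λ.m := this
        _ = (7 * Λ.M / (12 * Λ.m) + 1) * (12 * Λ.m) := by ring
        _ ≤ b * (12 * Λ.m) := Nat.mul_le_mul_right _ hb.1
    rw [Finset.mem_filter, Finset.mem_range]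
    have hbQ : b < Λ.Q := by
      show b < Λ.M / Λ.m
      have h1 : (b + 1) * Λ.m ≤ Λ.M := by nlinarith [hb2']
      exact Nat.lt_of_lt_of_le (Nat.lt_succ_self b) ((Nat.le_div_iff_mul_le hm).2 h1)
    refine ⟨hbQ, hbQ, ?_, ?_⟩
    · rw [hs, ← div_eq_mul_one_div, le_div_iff₀ hM0]
      have h : ((7 * Λ.M : ℕ) : ℝ) ≤ ((b * (12 * Λ.m) : ℕ) : ℝ) := by exact_mod_cast hb1'.le
      push_cast at h
      have e : ((b * Λ.m : ℕ) : ℝ) = (b : ℝ) * Λ.m := by push_cast; ring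
      rw [e]; linarith
    · rw [hs, ← div_eq_mul_one_div, div_le_iff₀ hM0]
      have h : (((b + 1) * (12 * Λ.m) : ℕ) : ℝ) ≤ ((11 * Λ.M : ℕ) : ℝ) := by exact_mod_cast hb2'
      push_cast at h
      have e : (((b + 1) * Λ.m : ℕ) : ℝ) = ((b : ℝ) + 1) * Λ.m := by push_cast; ring
      rw [e]; linarith
  -- count
  have hb₂ : (11 : ℝ) * Λ.M / (12 * Λ.m) - 1 ≤ (b₂ : ℝ) := by
    have := Nat.lt_div_mul_add (a := 11 * Λ.M) (b := 12 * Λ.m) (by positivity)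
    have h : ((11 * Λ.M : ℕ) : ℝ) < ((11 * Λ.M / (12 * Λ.m) * (12 * Λ.m) + 12 * Λ.m : ℕ) : ℝ) := by exact_mod_cast this
    push_cast at h
    rw [div_sub_one (by positivity), div_le_iff₀ (by positivity)]
    have e : ((11 * Λ.M / (12 * Λ.m) : ℕ) : ℝ) = (b₂ : ℝ) := by rw [hb₂]
    rw [e] at h
    linarith
  have hb₁ : (b₁ : ℝ) ≤ 7 * Λ.M / (12 * Λ.m) + 1 := by
    rw [hb₁]; push_cast
    have := Nat.cast_div_le (α := ℝ) (m := 7 * Λ.M) (n := 12 * Λ.m)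
    push_cast at this
    linarith
  have hMm : (24 : ℝ) * Λ.m ≤ Λ.M := by exact_mod_cast hM
  have hdiff : (Λ.M : ℝ) / (4 * Λ.m) ≤ (b₂ : ℝ) - b₁ := by
    have e1 : (11 : ℝ) * Λ.M / (12 * Λ.m) - 1 - (7 * Λ.M / (12 * Λ.m) + 1) = (Λ.M : ℝ) / (3 * Λ.m) - 2 := by
      field_simp; ring
    have e2 : (Λ.M : ℝ) / (4 * Λ.m) ≤ (Λ.M : ℝ) / (3 * Λ.m) - 2 := by
      rw [div_le_iff₀ (by positivity)]
      have : (Λ.M : ℝ) / (3 * Λ.m) * (4 * Λ.m) = (4 / 3) * Λ.M := by field_simp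
      nlinarith
    linarith
  have hle : b₁ ≤ b₂ := by
    have : (0 : ℝ) < (b₂ : ℝ) - b₁ := lt_of_lt_of_le (by positivity) hdiff
    exact_mod_cast (sub_pos.1 this).le
  calc (Λ.M : ℝ) / (4 * Λ.m) ≤ (b₂ : ℝ) - b₁ := hdiff
    _ = ((b₂ - b₁ : ℕ) : ℝ) := by rw [Nat.cast_sub hle]
    _ = ((Finset.Ico b₁ b₂).card : ℝ) := by rw [Nat.card_Ico]
    _ ≤ _ := by exact_mod_cast Finset.card_le_card hsub

end Lat

end Concrete

end EquilibriumClampedCollisionalWindowLDNegative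

end Summit.AtomisticToContinuum.HydrodynamicLimit.Theorems

end
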